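import Summits.QuantumFields.YangMills.Theses.LangevinControlUV
import Summits.QuantumFields.YangMills.Theorems.LangevinControlUVGapToContinuumStubDiagBoundToGap
import Literature.MathematicalPhysics.QuantumFieldTheory.MassGapFromLatticeClustering

/-!
# Skeleton of line `SketchIdeator4` for crux `GapToContinuum` (stmt-QuantumFields-8896), lead a1

Reshaped from round-2 ideator 4's evidence file (`Cruxes/GapToContinuum/SketchIdeator4.lean`, R5/L1)
into an eligible skeleton.  The composition is an EXACT reduction of the crux to its minimal core:

* `stub_diagBoundToGap` — **L1, continuum side — CLOSED** (Literature `OSData.hasMassGap_of_diagBound`,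
  p124697 + p124879; Theorems stub p125787): for OS data `T` on
  `ℝ^d`, `d ≥ 2`, a DIAGONAL exponential bound with a FREE constant per single slab-ordered real
  product tensor `P` (every arity `n ≥ 1`, every label string `k`),
  `‖𝔖₂ₙ^{rev k ++ k}(ΘP* ⊗ T_t P) − 𝔖ₙ^{rev k}(ΘP*) 𝔖ₙ^{k}(P)‖ ≤ C(P) e^{−Δt}` (`t ≥ 0`),
  already gives the full-spectrum gap `T.HasMassGap Δ` — by E2 log-convexity of
  `t ↦ ⟨v, e^{−tH} v⟩` with INFINITE horizon (the constant self-improves to the OS variance),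
  positivity of `e^{−tH}` on spans, Cauchy–Schwarz, and the tree's `OSData.hasMassGap_of_csBound_span`.
* `stub_diagBound_of_latticeGap` — **the lattice core**: `IsYangMillsFor r sch T` and
  `HasLatticeMassGap r sch Δ` give that diagonal bound for `T`.  Since the diagonal bound is
  trivially NECESSARY for `T.HasMassGap Δ`, this stub is EQUIVALENT to the typed crux given L1: the
  crux is exactly as hard as its single-tensor, free-constant, diagonal special case.  (It inherits
  the defects D2 = per-pair thresholds vs the `k`-growing family of translated product species and
  D3(b) = own-torus inheritance in absolute vs renormalised currency; see `Lines/*dead*.md`.)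

`GapToContinuum_of` concludes the crux BY NAME from the two stubs.
-/

namespace Summit.QuantumFields.YangMills.Cruxes.GapToContinuum.SketchIdeator4

open scoped SchwartzMap
open Filter
open Literature.MathematicalPhysics.AQFT Literature.MathematicalPhysics.QuantumLattice
open Literature.MathematicalPhysics.QuantumFieldTheory

/-- **Stub L1 (continuum-side diagonal self-improvement) — CLOSED** (landed p125787,
`Theorems/LangevinControlUVGapToContinuumStubDiagBoundToGap.lean`, from the Literature theorem
`OSData.hasMassGap_of_diagBound`, p124697 + p124879).  Diagonal exponential bounds with free
constants on the slab-ordered real product tensors give the full-spectrum mass gap of OS data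
(`d ≥ 2`). -/
theorem stub_diagBoundToGap :
    ∀ (ι : Type) (d : ℕ) [NeZero d], 1 < d → ∀ (T : OSData ι d) (Δ : ℝ),
      (∀ (n : ℕ), n ≠ 0 → ∀ (k : Fin n → ι) (P : 𝓢((Fin n → EuclideanSpace ℝ (Fin d)), ℂ)),
        P ∈ slabOrderedProducts d n → ∃ C : ℝ, ∀ t : ℝ, 0 ≤ t →
          ‖T.schwinger (n + n) (Fin.append (k ∘ Fin.rev) k)
                ((osAdjoint P).appendTensor (translateMulti (EuclideanSpace.single 0 t) P)) -
              T.schwinger n (k ∘ Fin.rev) (osAdjoint P) * T.schwinger n k P‖ ≤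
            C * Real.exp (-Δ * t)) →
      T.HasMassGap Δ :=
  Summit.QuantumFields.YangMills.Theorems.GapToContinuum.SketchIdeator4.stub_diagBoundToGap

/-- **Stub (lattice core) — OPEN; by `gapToContinuum_iff_diagonalCore` (p125787) it is EQUIVALENT to
the typed crux, and it is unprovable as typed (D2 per-pair thresholds vs the k-growing pair family,
D3(b) absolute per-pair constants vs free renormalisations on the own time-periodic tori; see
`Lines/SketchIdeator4-dead-a1.md`).**  The Yang–Mills identification and the per-pair lattice mass gap give
the diagonal exponential bound of `T` on every slab-ordered real product tensor. -/
theorem stub_diagBound_of_latticeGap :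
    ∀ (G : Type) [Group G] [TopologicalSpace G] [IsTopologicalGroup G] [CompactSpace G]
      [MeasurableSpace G] [BorelSpace G] (r : LatticeRep G) (sch : SpeciesScheme (YMSpecies G))
      (T : OSData (YMSpecies G) 4) (Δ : ℝ), 0 < Δ → IsYangMillsFor r sch T →
        HasLatticeMassGap r sch Δ →
        ∀ (n : ℕ), n ≠ 0 → ∀ (k : Fin n → YMSpecies G)
          (P : 𝓢((Fin n → EuclideanSpace ℝ (Fin 4)), ℂ)),
          P ∈ slabOrderedProducts 4 n → ∃ C : ℝ, ∀ t : ℝ, 0 ≤ t →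
            ‖T.schwinger (n + n) (Fin.append (k ∘ Fin.rev) k)
                  ((osAdjoint P).appendTensor (translateMulti (EuclideanSpace.single 0 t) P)) -
                T.schwinger n (k ∘ Fin.rev) (osAdjoint P) * T.schwinger n k P‖ ≤
              C * Real.exp (-Δ * t) := by
  sorry

/-- **Composition**: the two stubs give the crux by name. -/
theorem GapToContinuum_of :
    Summit.QuantumFields.YangMills.Theses.LangevinControlUV.GapToContinuum := by
  intro G _ _ _ _ _ _ r sch T Δ hΔ hYM hlat
  exact stub_diagBoundToGap (YMSpecies G) 4 (by norm_num) T Δ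
    (stub_diagBound_of_latticeGap G r sch T Δ hΔ hYM hlat)

end Summit.QuantumFields.YangMills.Cruxes.GapToContinuum.SketchIdeator4
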